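import Literature.Computability.Cryptography.CubicClassTableLadder
import HarnessLib

/-!
# The ladder class table depends on its argument only through the three low blocks

Topic `Computability/Cryptography`; theorem-only companion of `CubicClassTable.lean` / `CubicClassTableLadder.lean` (crux
`LinnikCubicClassGroups.PureCubicClassGroupFBQP`, line `arakelov-giant-step-cycle`). The table `classTableOpQ F I cap v` reads `v` only through
the exponent block `Eof v = v mod W`, the grid index `jof v` and the coin block `κof v`; hence it is periodic with period
`Q₀ = W · 2^ℓy · 2^ℓκ` (`classTableOpQ_mod`), which is what pushes its Fourier-sampling law through the padding block
(`PeriodFinding.corrMass_dvd_periodic`). [Hallgren 2005, §4]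
-/

namespace Literature.Computability.Cryptography

namespace CubicClassTable

variable (F : WalkFns) (I : Inst)

namespace Inst

/-- `digit` depends on `v` only through `Eof v`. [folklore] -/
theorem digit_congr {v v' : ℕ} (h : I.Eof v = I.Eof v') (t : ℕ) : I.digit v t = I.digit v' t := by
  unfold digit; rw [h]

/-- `coins` depends on `v` only through `κof v`. [folklore] -/
theorem coins_congr {v v' : ℕ} (h : I.κof v = I.κof v') (i : ℕ) : I.coins v i = I.coins v' i := by
  unfold coins; rw [h]

/-- `tgt` depends on `v` only through `jof v`. [folklore] -/
theorem tgt_congr {v v' : ℕ} (h : I.jof v = I.jof v') : I.tgt v = I.tgt v' := by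
  unfold tgt; rw [h]

/-- The three low blocks are `Q₀`-periodic, `Q₀ = W · 2^ℓy · 2^ℓκ`. [folklore] -/
theorem blocks_mod (v : ℕ) :
    I.Eof (v % (I.W * 2 ^ I.ℓy * 2 ^ I.ℓκ)) = I.Eof v ∧ I.jof (v % (I.W * 2 ^ I.ℓy * 2 ^ I.ℓκ)) = I.jof v ∧
      I.κof (v % (I.W * 2 ^ I.ℓy * 2 ^ I.ℓκ)) = I.κof v := by
  refine ⟨?_, ?_, ?_⟩
  · unfold Eof
    rw [mul_assoc, Nat.mod_mul_right_mod]
  · unfold jof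
    rw [mul_assoc, Nat.mod_mul_right_div_self, Nat.mod_mul_right_mod]
  · unfold κof
    rw [Nat.mod_mul_right_div_self, Nat.mod_mod]

end Inst

namespace WalkFns

variable {F I}

/-- `gens` depends on `v` only through the coins. [folklore] -/
theorem gens_congr {v v' : ℕ} (h : I.κof v = I.κof v') : F.gens I v = F.gens I v' := by
  unfold gens; simp_rw [Inst.coins_congr I h]

/-- `gT` depends on `v` only through the coins. [folklore] -/
theorem gT_congr {v v' : ℕ} (h : I.κof v = I.κof v') (t : ℕ) : F.gT I v t = F.gT I v' t := by
  unfold gT; rw [gens_congr h]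

/-- `bEc` depends on `v` only through `Eof v` and `κof v`. [folklore] -/
theorem bEc_congr {v v' : ℕ} (hE : I.Eof v = I.Eof v') (hκ : I.κof v = I.κof v') (cap : ℕ) :
    F.bEc I cap v = F.bEc I cap v' := by
  unfold bEc; simp_rw [gT_congr hκ, Inst.digit_congr I hE]

/-- `Δc` depends on `v` only through the three blocks. [folklore] -/
theorem Δc_congr {v v' : ℕ} (hE : I.Eof v = I.Eof v') (hj : I.jof v = I.jof v') (hκ : I.κof v = I.κof v') (cap : ℕ) :
    F.Δc I cap v = F.Δc I cap v' := by
  unfold Δc; rw [Inst.tgt_congr I hj, bEc_congr hE hκ]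

/-- `tstarc` depends on `v` only through the three blocks. [folklore] -/
theorem tstarc_congr {v v' : ℕ} (hE : I.Eof v = I.Eof v') (hj : I.jof v = I.jof v') (hκ : I.κof v = I.κof v') (cap : ℕ) :
    F.tstarc I cap v = F.tstarc I cap v' := by
  unfold tstarc; rw [Δc_congr hE hj hκ, bEc_congr hE hκ]

/-- `c0q` depends on `v` only through the three blocks. [folklore] -/
theorem c0q_congr {v v' : ℕ} (hE : I.Eof v = I.Eof v') (hj : I.jof v = I.jof v') (hκ : I.κof v = I.κof v') (cap : ℕ) :
    F.c0q I cap v = F.c0q I cap v' := by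
  unfold c0q; rw [tstarc_congr hE hj hκ, bEc_congr hE hκ]

/-- `babyStepc` depends on `v` only through the three blocks. [folklore] -/
theorem babyStepc_congr {v v' : ℕ} (hE : I.Eof v = I.Eof v') (hj : I.jof v = I.jof v') (hκ : I.κof v = I.κof v') (cap : ℕ) :
    F.babyStepc I cap v = F.babyStepc I cap v' := by
  funext st; unfold babyStepc; rw [tstarc_congr hE hj hκ]

/-- `cfinq` depends on `v` only through the three blocks. [folklore] -/
theorem cfinq_congr {v v' : ℕ} (hE : I.Eof v = I.Eof v') (hj : I.jof v = I.jof v') (hκ : I.κof v = I.κof v') (cap : ℕ) :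
    F.cfinq I cap v = F.cfinq I cap v' := by
  unfold cfinq; rw [babyStepc_congr hE hj hκ, c0q_congr hE hj hκ]

/-- **The ladder class table depends on `v` only through `Eof v`, `jof v`, `κof v`.** [cite: Hallgren2005, §4] -/
theorem classTableOpQ_congr {v v' : ℕ} (hE : I.Eof v = I.Eof v') (hj : I.jof v = I.jof v') (hκ : I.κof v = I.κof v')
    (cap : ℕ) : F.classTableOpQ I cap v = F.classTableOpQ I cap v' := by
  unfold classTableOpQ; rw [cfinq_congr hE hj hκ, tstarc_congr hE hj hκ]

variable (F I)

/-- **The ladder class table is `Q₀`-periodic**, `Q₀ = W · 2^ℓy · 2^ℓκ`. [cite: Hallgren2005, §4] -/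
theorem classTableOpQ_mod (cap v : ℕ) :
    F.classTableOpQ I cap (v % (I.W * 2 ^ I.ℓy * 2 ^ I.ℓκ)) = F.classTableOpQ I cap v := by
  obtain ⟨hE, hj, hκ⟩ := I.blocks_mod v
  exact classTableOpQ_congr hE hj hκ cap

end WalkFns

end CubicClassTable

end Literature.Computability.Cryptography
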